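import Summits.Ventures.LatticeQCDFlow.Scaling.DominatedStarAutocorrelationCeiling
import Summits.Ventures.LatticeQCDFlow.Scaling.DominatedStarMixingLaw

/-!
HONEST FRAMING: exact (Metropolis-corrected) sampling algorithms for lattice gauge theory; figures
of merit are autocorrelation/cost numbers at stated couplings and volumes; no continuum-physics
claim.

# DominatedStarUniformListing — THE UNIFORM HUB LIST IS EXTREMAL FOR EVERY CHAPTER-M CONSTANT (`K·c ≤ m`, SO THE RATE
# `tcp/(2m)` IS AT MOST `tp/(2K)`), AND AT `m = cK` THE INSTRUMENTABLE NUMBERS READ: `t_rel ≤ 2K/(tp)`,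
# `τ_int(g) ≤ 2K/(tp) − ½` FOR EVERY OBSERVABLE, BURN-IN `⌈(2K/(tp))·log(2(2K+p)/(pε))⌉` AND
# `N ≥ (4Var_π̃(f)/(η²ε))·(2K/(tp))` SAMPLES; WITH THE SWAP-ODDS WEIGHT THE TWO-SIDED LAW IS
# `(K/θ_Σ − 1)·log(K/4) ≤ t_mix(1/4) ≤ ⌈(m/(tc(p − 2t/h)))·log(4(K+b)/b)⌉`, `b = 2t/h` (lean-2 GEN-26, ours)

Venture-side (OURS).  Cell `lqcd-flow` (pub-lqcd), unit `pub-lqcd-lean-2-g26`, 2026-08-27.  Chapter M, file 26 — the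
numbers an experiment logs, at the natural operating point.  Setting of `Scaling/DominatedStarMixingCeiling` with
reversible cold kernels; `c ≤ c_k = #{r : κ_r = k}` for every cold level, `h = (1−t)w_0`, `θ_Σ = t + (1−t)(1−w_0)`.

## What is proved

* §1 **`hubMult_min_mul_le`** — `K·c ≤ m`; **`dominatedStar_rate_le_uniform`** — `tcp/(2m) ≤ tp/(2K)`: no proposal law
  over the hub edges improves the chapter-M rate beyond the uniform list's.
* §2 at `m = cK` (`|S| ≥ 2`, one-sided domination, `4t ≤ p·h`, `0 < t`): **`uniformStar_relaxationTime_le`**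
  (`t_rel ≤ 2K/(tp)`), **`uniformStar_tauInt_le`** (`τ_int(g) ≤ 1/(tp/(2K)) − ½` for every `g`),
  **`uniformStar_timeAverage`** (burn-in `r ≥ ⌈(2K/(tp))·log((2K+p)/(p·ε/2))⌉`, `N ≥ (4Var_π̃(f)/(η²ε))·(2K/(tp))`,
  `N ≥ 1` ⇒ `P_x{|N⁻¹Σ_{s<N} f(X_{r+s}) − E_π̃ f| ≥ η} ≤ ε`).
* §3 **`oddsStar_mixingTime_two_sided`** — general `m`, `K ≥ 2`, `2t < p·h`, rare cold start:
  **`(K/θ_Σ − 1)·log(K/4) ≤ t_mix(1/4) ≤ ⌈(m/(tc(p − b)))·log((K+b)/(b/4))⌉`** with `b = 2t/h`.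

Reading (no numerics implied): at uniform listing the whole chapter reads in the single unit `2K/(tp)` sweeps — the
relaxation time, twice the autocorrelation time of any observable, the burn-in up to `log(K/(pε))`, and the sample
size per unit of `Var(f)/(η²ε)`; listing some cold levels more often than others can only lower `c/m` below `1/K`.
NOT CLAIMED: that uniform listing is optimal for the true mixing time (only for these bounds); anything measured.
Literature grade (cell rule): OWN RESULT; nothing cited as a fact; no new bib keys.
-/

noncomputable section

open Finset Function
open Literature.Probability.MarkovChains

namespace Summit.Ventures.LatticeQCDFlow.Scaling

variable {S : Type*} [Fintype S] [DecidableEq S] {K m : ℕ} {μ : Fin (K + 1) → S → ℝ} {M : Fin (K + 1) → S → S → ℝ}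
  {w : Fin (K + 1) → ℝ} {t p : ℝ}

section Uniform
variable (κ : Fin m → Fin K) (φ : Fin m → Equiv.Perm S)

/-! ## §1 The uniform list is extremal -/

/-- **`K·c ≤ m`:** a common lower bound `c` on the multiplicities of the `K` cold levels in a hub list of length `m`.
[ours] -/
theorem hubMult_min_mul_le {c : ℕ} (hc : ∀ p' : Fin K, c ≤ (univ.filter (fun r : Fin m => κ r = p')).card) :
    (K : ℝ) * c ≤ m := by
  calc (K : ℝ) * c = ∑ _k : Fin K, (c : ℝ) := by rw [sum_const, card_univ, Fintype.card_fin, nsmul_eq_mul]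
    _ ≤ ∑ k : Fin K, ((univ.filter (fun r : Fin m => κ r = k)).card : ℝ) :=
        sum_le_sum fun k _ => by exact_mod_cast hc k
    _ = m := hubList_sum_degree κ

/-- **THE CHAPTER-M RATE NEVER EXCEEDS THE UNIFORM LIST'S: `tcp/(2m) ≤ tp/(2K)`** (`K ≥ 1`, `0 ≤ t`, `0 ≤ p`). [ours] -/
theorem dominatedStar_rate_le_uniform (hK : 1 ≤ K) (ht0 : 0 ≤ t) (hp0 : 0 ≤ p) {c : ℕ} (hc1 : 1 ≤ c)
    (hc : ∀ p' : Fin K, c ≤ (univ.filter (fun r : Fin m => κ r = p')).card) :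
    t * c * p / (2 * m) ≤ t * p / (2 * K) := by
  have hKc := hubMult_min_mul_le κ hc
  have hKpos : (0 : ℝ) < K := Nat.cast_pos.mpr (by omega)
  have hcpos : (0 : ℝ) < c := Nat.cast_pos.mpr (by omega)
  have hmpos : (0 : ℝ) < m := lt_of_lt_of_le (by positivity) hKc
  rw [div_le_div_iff₀ (by positivity) (by positivity)]
  have := mul_le_mul_of_nonneg_left hKc (by positivity : 0 ≤ t * p)
  nlinarith

/-! ## §2 The instrumentable numbers at `m = cK` -/

/-- **`t_rel ≤ 2K/(tp)` AT UNIFORM LISTING** (one-sided domination, `4t ≤ p(1−t)w_0`, `0 < t`, reversible cold kernels).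
[ours] -/
theorem uniformStar_relaxationTime_le (ht0 : 0 < t) (ht1 : t ≤ 1) (hw0 : ∀ k, 0 ≤ w k) (hw1 : ∑ k, w k = 1)
    (hμ : ∀ k x, 0 < μ k x) (hμ1 : ∀ k, ∑ u, μ k u = 1) (hM : ∀ k, IsRowStochastic (M k))
    (hMrev : ∀ k, DetailedBalance (μ k) (M k)) (hM0 : ∀ u v, M 0 u v = μ 0 v) (hp0 : 0 < p) (hp1 : p ≤ 1)
    (hdom : ∀ r u, p * μ (κ r).succ (φ r u) ≤ μ 0 u) (hreg : 4 * t ≤ p * (1 - t) * w 0) {c : ℕ} (hc1 : 1 ≤ c) (hK : 1 ≤ K)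
    (hc : ∀ p' : Fin K, c ≤ (univ.filter (fun r : Fin m => κ r = p')).card) (hmc : m = c * K) :
    relaxationTime (fun y z : Fin (K + 1) → S =>
        t * ptGraphSwap μ (fun r : Fin m => (((0 : Fin (K + 1)), (κ r).succ) : Fin (K + 1) × Fin (K + 1))) φ y z
          + (1 - t) * prodKernel w M y z) ≤ 2 * K / (t * p) := by
  have hm : 1 ≤ m := by rw [hmc]; exact Nat.one_le_iff_ne_zero.mpr (Nat.mul_ne_zero (by omega) (by omega))
  have hcm : c ≤ m := by rw [hmc]; exact Nat.le_mul_of_pos_right c (by omega)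
  have h := dominatedStar_relaxationTime_le κ φ hm ht0 ht1 hw0 hw1 hμ hμ1 hM hMrev hM0 hp0 hp1 hdom hreg hc1 hc hcm
  have hcpos : (0 : ℝ) < c := Nat.cast_pos.mpr (by omega)
  have hmR : (m : ℝ) = c * K := by rw [hmc, Nat.cast_mul]
  have e : 2 * (m : ℝ) / (t * c * p) = 2 * K / (t * p) := by
    rw [hmR]; field_simp
  rwa [e] at h

/-- **`τ_int(g) ≤ 1/(tp/(2K)) − ½` FOR EVERY OBSERVABLE AT UNIFORM LISTING** (`|S| ≥ 2`). [ours] -/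
theorem uniformStar_tauInt_le [Nontrivial S] (ht0 : 0 < t) (ht1 : t ≤ 1) (hw0 : ∀ k, 0 ≤ w k) (hw1 : ∑ k, w k = 1)
    (hμ : ∀ k x, 0 < μ k x) (hμ1 : ∀ k, ∑ u, μ k u = 1) (hM : ∀ k, IsRowStochastic (M k))
    (hMrev : ∀ k, DetailedBalance (μ k) (M k)) (hM0 : ∀ u v, M 0 u v = μ 0 v) (hp0 : 0 < p) (hp1 : p ≤ 1)
    (hdom : ∀ r u, p * μ (κ r).succ (φ r u) ≤ μ 0 u) (hreg : 4 * t ≤ p * (1 - t) * w 0) {c : ℕ} (hc1 : 1 ≤ c) (hK : 1 ≤ K)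
    (hc : ∀ p' : Fin K, c ≤ (univ.filter (fun r : Fin m => κ r = p')).card) (hmc : m = c * K)
    (g : (Fin (K + 1) → S) → ℝ) :
    asympVar g (tensorFun μ) (fun y z : Fin (K + 1) → S =>
        t * ptGraphSwap μ (fun r : Fin m => (((0 : Fin (K + 1)), (κ r).succ) : Fin (K + 1) × Fin (K + 1))) φ y z
          + (1 - t) * prodKernel w M y z) / (2 * lawVariance (tensorFun μ) g)
      ≤ 1 / (t * p / (2 * K)) - 1 / 2 := by
  have hm : 1 ≤ m := by rw [hmc]; exact Nat.one_le_iff_ne_zero.mpr (Nat.mul_ne_zero (by omega) (by omega))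
  have hcm : c ≤ m := by rw [hmc]; exact Nat.le_mul_of_pos_right c (by omega)
  have h := dominatedStar_tauInt_le κ φ hm ht0 ht1 hw0 hw1 hμ hμ1 hM hMrev hM0 hp0 hp1 hdom hreg hc1 hc hcm g
  have hcpos : (0 : ℝ) < c := Nat.cast_pos.mpr (by omega)
  have hmR : (m : ℝ) = c * K := by rw [hmc, Nat.cast_mul]
  have e : t * c * p / (2 * (m : ℝ)) = t * p / (2 * K) := by
    rw [hmR]; field_simp
  rwa [e] at h

/-- **THE SAMPLE-SIZE RULE AT UNIFORM LISTING** (`|S| ≥ 2`): burn-in `r ≥ ⌈(2K/(tp))·log((2K+p)/(p·ε/2))⌉`, sample size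
`N ≥ 1` with `N ≥ (4Var_π̃(f)/(η²ε))·(2K/(tp))` ⇒ `P_x{|N⁻¹Σ_{s<N} f(X_{r+s}) − E_π̃ f| ≥ η} ≤ ε` from every start.
[ours] -/
theorem uniformStar_timeAverage [Nontrivial S] (ht0 : 0 < t) (ht1 : t ≤ 1) (hw0 : ∀ k, 0 ≤ w k) (hw1 : ∑ k, w k = 1)
    (hμ : ∀ k x, 0 < μ k x) (hμ1 : ∀ k, ∑ u, μ k u = 1) (hM : ∀ k, IsRowStochastic (M k))
    (hMrev : ∀ k, DetailedBalance (μ k) (M k)) (hM0 : ∀ u v, M 0 u v = μ 0 v) (hp0 : 0 < p) (hp1 : p ≤ 1)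
    (hdom : ∀ r u, p * μ (κ r).succ (φ r u) ≤ μ 0 u) (hreg : 4 * t ≤ p * (1 - t) * w 0) {c : ℕ} (hc1 : 1 ≤ c) (hK : 1 ≤ K)
    (hc : ∀ p' : Fin K, c ≤ (univ.filter (fun r : Fin m => κ r = p')).card) (hmc : m = c * K)
    (f : (Fin (K + 1) → S) → ℝ) {ε η : ℝ} (hε : 0 < ε) (hη : 0 < η) {r N : ℕ}
    (hr : ⌈2 * (K : ℝ) / (t * p) * Real.log ((2 * (K : ℝ) + p) / (p * (ε / 2)))⌉₊ ≤ r) (hN : 0 < N)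
    (hNvar : 4 * lawVariance (tensorFun μ) f / (η ^ 2 * ε) * (2 * K / (t * p)) ≤ N) (x : Fin (K + 1) → S) :
    pathSum (fun y z : Fin (K + 1) → S =>
        t * ptGraphSwap μ (fun r : Fin m => (((0 : Fin (K + 1)), (κ r).succ) : Fin (K + 1) × Fin (K + 1))) φ y z
          + (1 - t) * prodKernel w M y z) (N + r) x (fun ω =>
        if η ≤ |(∑ s : Fin N, f ((Matrix.vecCons x ω : Fin (N + r + 1) → (Fin (K + 1) → S))
              ⟨(s : ℕ) + r, by have := s.isLt; omega⟩)) / N - lawMean (tensorFun μ) f|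
          then (1 : ℝ) else 0) ≤ ε := by
  have hm : 1 ≤ m := by rw [hmc]; exact Nat.one_le_iff_ne_zero.mpr (Nat.mul_ne_zero (by omega) (by omega))
  have hcm : c ≤ m := by rw [hmc]; exact Nat.le_mul_of_pos_right c (by omega)
  have hcpos : (0 : ℝ) < c := Nat.cast_pos.mpr (by omega)
  have hmR : (m : ℝ) = c * K := by rw [hmc, Nat.cast_mul]
  have e : 2 * (m : ℝ) / (t * c * p) = 2 * K / (t * p) := by
    rw [hmR]; field_simp
  refine dominatedStar_timeAverage κ φ hm ht0 ht1 hw0 hw1 hμ hμ1 hM hMrev hM0 hp0 hp1 hdom hreg hc1 hc hcm f hε hη ?_ hN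
    ?_ x
  · rw [e]; exact hr
  · rw [e]; exact hNvar

/-! ## §3 The two-sided law at the swap-odds weight -/

/-- **BOTH SIDES AT THE SWAP-ODDS WEIGHT `b = 2t/h`:** `K ≥ 2`, `0 < t < 1`, `w_0 > 0`, `2t < p·h`, reversible cold
kernels, exact hot sampler, one-sided domination, rare cold start `Σ_k μ_{k+1}(x_{k+1}) ≤ 1/4`:
**`(K/(t + (1−t)(1−w_0)) − 1)·log(K/4) ≤ t_mix(1/4) ≤ ⌈(m/(tc(p − b)))·log((K+b)/(b·(1/4)))⌉`**, `b = 2t/((1−t)w_0)`.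
[ours] -/
theorem oddsStar_mixingTime_two_sided (hK : 2 ≤ K) (hm : 1 ≤ m) (ht0 : 0 < t) (ht1 : t < 1) (hw0 : ∀ k, 0 ≤ w k)
    (hw00 : 0 < w 0) (hw1 : ∑ k, w k = 1) (hμ : ∀ k x, 0 < μ k x) (hμ1 : ∀ k, ∑ u, μ k u = 1)
    (hM : ∀ k, IsRowStochastic (M k)) (hMrev : ∀ k, DetailedBalance (μ k) (M k)) (hM0 : ∀ u v, M 0 u v = μ 0 v)
    (hp0 : 0 < p) (hp1 : p ≤ 1) (hdom : ∀ r u, p * μ (κ r).succ (φ r u) ≤ μ 0 u) (hreg : 2 * t < p * ((1 - t) * w 0))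
    {c : ℕ} (hc1 : 1 ≤ c) (hc : ∀ p' : Fin K, c ≤ (univ.filter (fun r : Fin m => κ r = p')).card) (hcm : c ≤ m)
    (x : Fin (K + 1) → S) (hx : ∑ k : Fin K, μ k.succ (x k.succ) ≤ 1 / 4) :
    ((K : ℝ) / (t + (1 - t) * (1 - w 0)) - 1) * Real.log (K / 4)
        ≤ (mixingTime (fun y z : Fin (K + 1) → S =>
            t * ptGraphSwap μ (fun r : Fin m => (((0 : Fin (K + 1)), (κ r).succ) : Fin (K + 1) × Fin (K + 1))) φ y z
              + (1 - t) * prodKernel w M y z) (tensorFun μ) (1 / 4) : ℝ) ∧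
      mixingTime (fun y z : Fin (K + 1) → S =>
            t * ptGraphSwap μ (fun r : Fin m => (((0 : Fin (K + 1)), (κ r).succ) : Fin (K + 1) × Fin (K + 1))) φ y z
              + (1 - t) * prodKernel w M y z) (tensorFun μ) (1 / 4)
        ≤ ⌈(m : ℝ) / (t * c * (p - 2 * t / ((1 - t) * w 0)))
            * Real.log (((K : ℝ) + 2 * t / ((1 - t) * w 0)) / (2 * t / ((1 - t) * w 0) * (1 / 4)))⌉₊ := by
  have hstat : ∀ k : Fin (K + 1), k ≠ 0 → ∀ v, ∑ u, μ k u * M k u v = μ k v :=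
    fun k _ v => (hMrev k).isStationary (hM k).2 v
  have hh : 0 < (1 - t) * w 0 := mul_pos (by linarith) hw00
  have hb0 : 0 < 2 * t / ((1 - t) * w 0) := div_pos (by linarith) hh
  have hbp : 2 * t / ((1 - t) * w 0) < p := by rw [div_lt_iff₀ hh]; linarith
  have hreg' : 2 * t ≤ (1 - t) * w 0 * (2 * t / ((1 - t) * w 0)) := by rw [mul_div_cancel₀ _ hh.ne']
  refine ⟨?_, retunedStar_mixingTime_le κ φ hm ht0 ht1.le hw0 hw1 hμ hμ1 hM hM0 hstat hp0 hp1 hdom hb0 hbp hreg' hc1 hc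
    hcm (by norm_num)⟩
  have hmix : ∃ t₀, worstTvDist (fun y z : Fin (K + 1) → S =>
      t * ptGraphSwap μ (fun r : Fin m => (((0 : Fin (K + 1)), (κ r).succ) : Fin (K + 1) × Fin (K + 1))) φ y z
        + (1 - t) * prodKernel w M y z) (tensorFun μ) t₀ ≤ 1 / 4 :=
    ⟨_, retunedStar_worstTvDist_le_of_ge_log κ φ hm ht0 ht1.le hw0 hw1 hμ hμ1 hM hM0 hstat hp0 hp1 hdom hb0 hbp hreg'
      hc1 hc hcm (by norm_num : (0:ℝ) < 1 / 4) (Nat.le_ceil _)⟩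
  exact hubList_mixingTime_ge_quarter κ φ hK hm hμ hμ1 hM hMrev hw0 hw1 ht0.le ht1.le
    (touchRateSum_pos ht0 ht1.le (weight_zero_le_one hw0 hw1)) x hx hmix

end Uniform

end Summit.Ventures.LatticeQCDFlow.Scaling

end
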